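import Literature.NumberTheory.Sieve.EulerMascheroniEin
import Literature.NumberTheory.LFunctions.HalaszIntegration
import HarnessLib

/-!
# Granville–Soundararajan 2003, §4: the `α`-integrals and the constant `12/7`

Eighth file of the proof of Theorem 1 of Granville–Soundararajan (sharp Halász): the real-variable
calculus of §4 of the paper ((4.3)–(4.4)).  With `ℓ = log x`, `K(α) = (1 - x^{-2α})/(2α)
= (1 - e^{-2ℓα})/(2α) = ℓ g(2ℓα)` (`g = einKernel`, `Ein = ∫_0 g` of `Sieve.SieveAdjointP`):
* `∫_a^b K = ½ (Ein(2ℓb) - Ein(2ℓa))` and `∫_a^b K/α = ℓ ∫_{2ℓa}^{2ℓb} (1-e^{-y})/y² dy`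
  (the changes of variables `y = 2α log x` of the paper);
* `∫_A^M (1-e^{-y})/y² = (1/A - 1/M) - ∫_A^M e^{-y}/y²`, `E₁(A) = ∫_A^M e^{-y}/y + E₁(M)`,
  `E₁(M) ≤ e^{-M}/M`, and the pointwise `e^{-y}(L/y - 2/y²) ≤ (L²/8) e^{-y}`;
* the main-term inequalities: for `0 < L`, `Lℓ ≤ 1`: `L·Ein(2ℓ) ≤ L(log(e^γ/L) + 12/7)`, and for
  `1 < Lℓ < ℓ` (`A = 2/L`, `M = 2ℓ`): `L·Ein(A) + 2∫_A^M (1-e^{-y})/y² ≤ L(log(e^γ/L) + 12/7)`,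
  using Euler's integral `Ein(A) = γ + log A + E₁(A)` (`Sieve.ein_eq_add`) and
  `1 + log 2 + 1/(8e²) ≤ 12/7`;
* the error integrals over `α ∈ [1/ℓ², 1]`: `∫ (1 + 1/α) ≤ 1 + 2 log ℓ`, `∫ α^{-1/2} ≤ 2`,
  `∫ min(ℓ, 1/α)² ≤ 2ℓ`;
* the two trivial regimes: `L(log(e^γ/L) + 12/7) ≥ 1` for `1 ≤ L ≤ 9/4`, and `≥ -L₀ log L₀` for
  `0 ≤ L ≤ L₀`, `1 ≤ L₀`.

## References
- [GranvilleSoundararajan2003] A. Granville, K. Soundararajan, *Decay of mean values of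
  multiplicative functions*, Canad. J. Math. 55 (2003), §4, (4.3)–(4.4), arXiv math/9911246 p. 8.
-/

noncomputable section

open Real MeasureTheory Set intervalIntegral

namespace Literature.NumberTheory.LFunctions

namespace GranvilleSoundararajan

open Literature.NumberTheory.Sieve (einKernel ein expIntegralE1 einKernel_eq_div continuous_einKernel
  ein_eq_add ein_monotone ein_nonneg expIntegralE1_eq integrableOn_exp_neg_div_Ioi)

/-! ### The kernel `K(α) = (1 - e^{-2ℓα})/(2α) = ℓ g(2ℓα)` and its integrals -/

/-- `(1 - e^{-2ℓα})/(2α) = ℓ g(2ℓα)` for `α ≠ 0`, `ℓ ≠ 0` (`g = einKernel`). [folklore] -/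
theorem K_eq_mul_einKernel {ℓ α : ℝ} (hℓ : ℓ ≠ 0) (hα : α ≠ 0) :
    (1 - Real.exp (-(2 * ℓ * α))) / (2 * α) = ℓ * einKernel (2 * ℓ * α) := by
  rw [einKernel_eq_div (by positivity : 2 * ℓ * α ≠ 0)]
  field_simp

/-- **`∫_a^b K(α) dα = ½ (Ein(2ℓb) - Ein(2ℓa))`** for `0 < a ≤ b`, `ℓ > 0` (the change of
variables `y = 2α log x` of GS03 §4). [cite: GranvilleSoundararajan2003, §4 ("Making a change of variables `y = 2α log x`")] -/
theorem integral_K_eq {ℓ a b : ℝ} (hℓ : 0 < ℓ) (ha : 0 < a) (hab : a ≤ b) :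
    ∫ α in a..b, (1 - Real.exp (-(2 * ℓ * α))) / (2 * α) = (ein (2 * ℓ * b) - ein (2 * ℓ * a)) / 2 := by
  have hcongr : ∫ α in a..b, (1 - Real.exp (-(2 * ℓ * α))) / (2 * α) = ∫ α in a..b, ℓ * einKernel ((2 * ℓ) * α) := by
    refine intervalIntegral.integral_congr fun α hα => ?_
    rw [Set.uIcc_of_le hab] at hα
    have hα0 : α ≠ 0 := ne_of_gt (ha.trans_le hα.1)
    rw [K_eq_mul_einKernel hℓ.ne' hα0, mul_assoc]
  rw [hcongr, intervalIntegral.integral_const_mul,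
    intervalIntegral.integral_comp_mul_left (f := einKernel) (by positivity : 2 * ℓ ≠ 0), smul_eq_mul]
  have hsub : ∫ t in (2 * ℓ * a)..(2 * ℓ * b), einKernel t = ein (2 * ℓ * b) - ein (2 * ℓ * a) := by
    unfold ein
    rw [intervalIntegral.integral_interval_sub_left (continuous_einKernel.intervalIntegrable _ _)
      (continuous_einKernel.intervalIntegrable _ _)]
  rw [hsub]
  field_simp

/-- **`∫_a^b K(α)/α dα = ℓ ∫_{2ℓa}^{2ℓb} (1 - e^{-y})/y² dy`** for `0 < a ≤ b`, `ℓ > 0`.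
[cite: GranvilleSoundararajan2003, §4 ("the second integral in (4.3) is …")] -/
theorem integral_K_div_eq {ℓ a b : ℝ} (hℓ : 0 < ℓ) (ha : 0 < a) (hab : a ≤ b) :
    ∫ α in a..b, (1 - Real.exp (-(2 * ℓ * α))) / (2 * α) / α =
      ℓ * ∫ y in (2 * ℓ * a)..(2 * ℓ * b), (1 - Real.exp (-y)) / y ^ 2 := by
  set G : ℝ → ℝ := fun y => (1 - Real.exp (-y)) / y ^ 2 with hG
  have hcongr : ∫ α in a..b, (1 - Real.exp (-(2 * ℓ * α))) / (2 * α) / α =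
      ∫ α in a..b, (ℓ * (2 * ℓ)) * G ((2 * ℓ) * α) := by
    refine intervalIntegral.integral_congr fun α hα => ?_
    rw [Set.uIcc_of_le hab] at hα
    have hα0 : α ≠ 0 := ne_of_gt (ha.trans_le hα.1)
    simp only [hG]
    field_simp
  rw [hcongr, intervalIntegral.integral_const_mul,
    intervalIntegral.integral_comp_mul_left (f := G) (by positivity : 2 * ℓ ≠ 0), smul_eq_mul]
  field_simp

/-- `∫_A^M (1 - e^{-y})/y² dy = (1/A - 1/M) - ∫_A^M e^{-y}/y² dy` for `0 < A ≤ M`. [folklore] -/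
theorem integral_one_sub_exp_div_sq {A M : ℝ} (hA : 0 < A) (hAM : A ≤ M) :
    ∫ y in A..M, (1 - Real.exp (-y)) / y ^ 2 = (1 / A - 1 / M) - ∫ y in A..M, Real.exp (-y) / y ^ 2 := by
  have hne : ∀ y ∈ Set.uIcc A M, y ≠ 0 := by
    intro y hy; rw [Set.uIcc_of_le hAM] at hy; exact ne_of_gt (hA.trans_le hy.1)
  have h1 : IntervalIntegrable (fun y : ℝ => 1 / y ^ 2) volume A M := by
    refine (continuousOn_const.div (continuousOn_id.pow 2) fun y hy => ?_).intervalIntegrable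
    exact pow_ne_zero 2 (hne y hy)
  have h2 : IntervalIntegrable (fun y : ℝ => Real.exp (-y) / y ^ 2) volume A M := by
    refine ((Real.continuous_exp.comp continuous_neg).continuousOn.div (continuousOn_id.pow 2)
      fun y hy => ?_).intervalIntegrable
    exact pow_ne_zero 2 (hne y hy)
  have hsplit : ∫ y in A..M, (1 - Real.exp (-y)) / y ^ 2 = (∫ y in A..M, 1 / y ^ 2) - ∫ y in A..M, Real.exp (-y) / y ^ 2 := by
    rw [← intervalIntegral.integral_sub h1 h2]
    refine intervalIntegral.integral_congr fun y _ => ?_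
    exact sub_div _ _ _
  rw [hsplit, Halasz.integral_one_div_sq hA hAM]

/-- `E₁(A) = ∫_A^M e^{-y}/y dy + E₁(M)` for `0 < A ≤ M`. [folklore] -/
theorem expIntegralE1_eq_integral_add {A M : ℝ} (hA : 0 < A) (hAM : A ≤ M) :
    expIntegralE1 A = (∫ y in A..M, Real.exp (-y) / y) + expIntegralE1 M := by
  have hM : 0 < M := hA.trans_le hAM
  rw [expIntegralE1_eq hA, expIntegralE1_eq hM]
  have hint : ∀ {u v : ℝ}, 0 < u → 0 < v → IntervalIntegrable (fun t : ℝ => Real.exp (-t) / t) volume u v := by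
    intro u v hu hv
    refine ((Real.continuous_exp.comp continuous_neg).continuousOn.div continuousOn_id fun t ht => ?_).intervalIntegrable
    have : min u v ≤ t := by rw [Set.uIcc] at ht; exact ht.1
    exact ne_of_gt (lt_of_lt_of_le (lt_min hu hv) this)
  have := intervalIntegral.integral_add_adjacent_intervals (hint one_pos hA) (hint hA hM)
  linarith

/-- `0 ≤ E₁(M) ≤ e^{-M}/M` for `M > 0`. [folklore] -/
theorem expIntegralE1_le {M : ℝ} (hM : 0 < M) :
    0 ≤ expIntegralE1 M ∧ expIntegralE1 M ≤ Real.exp (-M) / M := by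
  constructor
  · exact setIntegral_nonneg measurableSet_Ioi fun t (ht : M < t) =>
      div_nonneg (Real.exp_pos _).le (hM.trans ht).le
  · unfold expIntegralE1
    have hexp : ∫ t in Set.Ioi M, Real.exp (-t) = Real.exp (-M) := by
      have := integral_exp_mul_Ioi (by norm_num : (-1:ℝ) < 0) M
      simp only [neg_mul, one_mul] at this
      rw [this]; norm_num
    calc ∫ t in Set.Ioi M, Real.exp (-t) / t ≤ ∫ t in Set.Ioi M, Real.exp (-t) * (1 / M) := by
          refine setIntegral_mono_on (integrableOn_exp_neg_div_Ioi hM)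
            ((integrableOn_exp_mul_Ioi (by norm_num : (-1:ℝ) < 0) M).congr_fun (fun t _ => by
              simp) measurableSet_Ioi |>.mul_const _) measurableSet_Ioi fun t (ht : M < t) => ?_
          rw [div_eq_mul_one_div]
          exact mul_le_mul_of_nonneg_left (one_div_le_one_div_of_le hM ht.le) (Real.exp_pos _).le
      _ = Real.exp (-M) / M := by rw [MeasureTheory.integral_mul_const, hexp, mul_one_div]

/-- The pointwise inequality `e^{-y} (L/y - 2/y²) ≤ (L²/8) e^{-y}` for `y > 0`
("the maximum of `(1 - (2/L)/y)/y` for `y ≥ 2/L` is attained at `y = 4/L`").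
[cite: GranvilleSoundararajan2003, §4 (after (4.4))] -/
theorem exp_mul_sub_le {L y : ℝ} (hy : 0 < y) :
    Real.exp (-y) * (L / y - 2 / y ^ 2) ≤ L ^ 2 / 8 * Real.exp (-y) := by
  rw [mul_comm]
  refine mul_le_mul_of_nonneg_right ?_ (Real.exp_pos _).le
  rw [div_sub_div _ _ hy.ne' (by positivity), div_le_div_iff₀ (by positivity) (by norm_num)]
  nlinarith [sq_nonneg (L * y - 4), sq_nonneg y]

/-! ### The constant `12/7` -/

/-- `e^{-2} < 0.1354`. [folklore] -/
theorem exp_neg_two_lt : Real.exp (-2) < 0.1354 := by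
  have h := Real.exp_one_gt_d9
  have h2 : Real.exp 2 = Real.exp 1 * Real.exp 1 := by rw [← Real.exp_add]; norm_num
  rw [Real.exp_neg, inv_lt_comm₀ (Real.exp_pos _) (by norm_num), h2]
  nlinarith

/-- `1 + log 2 + e^{-2}/8 ≤ 12/7` (GS03: "since `1 + log 2 + 1/(8e²) ≤ 12/7`").
[cite: GranvilleSoundararajan2003, §4 (last line of the proof of Theorem 1)] -/
theorem one_add_log_two_add_le : 1 + Real.log 2 + Real.exp (-2) / 8 ≤ 12 / 7 := by
  have h1 := Real.log_two_lt_d9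
  have h2 := exp_neg_two_lt
  linarith

/-- `E₁(2/L) ≤ e^{-2}/2 · 1` in the form `L · E₁(2/L) ≤ (L/2) e^{-2}`... precisely:
for `0 < L ≤ 1`, `E₁(2/L) ≤ (L/2) e^{-2}`. [folklore] -/
theorem expIntegralE1_two_div_le {L : ℝ} (hL : 0 < L) (hL1 : L ≤ 1) :
    expIntegralE1 (2 / L) ≤ L / 2 * Real.exp (-2) := by
  have hA : 0 < 2 / L := by positivity
  refine (expIntegralE1_le hA).2.trans ?_
  have hexp : Real.exp (-(2 / L)) ≤ Real.exp (-2) := by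
    rw [Real.exp_le_exp, neg_le_neg_iff, le_div_iff₀ hL]; nlinarith
  rw [div_div_eq_mul_div]
  calc Real.exp (-(2 / L)) * L / 2 ≤ Real.exp (-2) * L / 2 := by gcongr
    _ = L / 2 * Real.exp (-2) := by ring

/-- **Main term, case `L log x ≤ 1`**: for `0 < L`, `ℓ ≥ 1`, `Lℓ ≤ 1`,
`L · Ein(2ℓ) ≤ L (log(e^γ/L) + 12/7)`. [cite: GranvilleSoundararajan2003, §4, (4.3)–(4.4)] -/
theorem mainTerm_caseA {L ℓ : ℝ} (hL : 0 < L) (hℓ : 1 ≤ ℓ) (hLℓ : L * ℓ ≤ 1) :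
    L * ein (2 * ℓ) ≤ L * (Real.log (Real.exp Real.eulerMascheroniConstant / L) + 12 / 7) := by
  have hL1 : L ≤ 1 := by nlinarith
  refine mul_le_mul_of_nonneg_left ?_ hL.le
  have hmono : ein (2 * ℓ) ≤ ein (2 / L) := by
    apply ein_monotone
    rw [le_div_iff₀ hL]; nlinarith
  refine hmono.trans ?_
  rw [ein_eq_add (by positivity : 0 < 2 / L), Real.log_div (by norm_num) hL.ne',
    Real.log_div (Real.exp_pos _).ne' hL.ne', Real.log_exp]
  have hE := expIntegralE1_two_div_le hL hL1
  have he0 : 0 ≤ Real.exp (-2) := (Real.exp_pos _).le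
  have h3 := exp_neg_two_lt
  have h4 : L * Real.exp (-2) ≤ Real.exp (-2) := mul_le_of_le_one_left he0 hL1
  have h5 := Real.log_two_lt_d9
  linarith

/-- **Main term, case `1 < L log x < log x`**: for `0 < L < 1`, `ℓ ≥ 1`, `1 < Lℓ`, with
`A = 2/L`, `M = 2ℓ`:
`L · Ein(A) + 2 ∫_A^M (1 - e^{-y})/y² dy ≤ L (log(e^γ/L) + 12/7)`
(GS03 (4.4): the two `α`-ranges combine to `L(1 + log 2 + log(e^γ/L)) + ∫_{2/L}^∞ (e^{-y}/y)(1 - (2/L)/y) dy`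
and the last integral is `≤ 1/(8e²)`). [cite: GranvilleSoundararajan2003, §4, (4.4)] -/
theorem mainTerm_caseB {L ℓ : ℝ} (hL : 0 < L) (hL1 : L < 1) (hℓ : 1 ≤ ℓ) (hLℓ : 1 < L * ℓ) :
    L * ein (2 / L) + 2 * ∫ y in (2 / L)..(2 * ℓ), (1 - Real.exp (-y)) / y ^ 2 ≤
      L * (Real.log (Real.exp Real.eulerMascheroniConstant / L) + 12 / 7) := by
  set A : ℝ := 2 / L with hAdef
  set M : ℝ := 2 * ℓ with hMdef
  have hA : 0 < A := by positivity
  have hM : 0 < M := by positivity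
  have hAM : A ≤ M := by rw [hAdef, hMdef, div_le_iff₀ hL]; nlinarith
  have hne : ∀ y ∈ Set.uIcc A M, y ≠ 0 := by
    intro y hy; rw [Set.uIcc_of_le hAM] at hy; exact ne_of_gt (hA.trans_le hy.1)
  have hpos : ∀ y ∈ Set.Icc A M, 0 < y := fun y hy => hA.trans_le hy.1
  -- the pieces
  have hein : ein A = Real.eulerMascheroniConstant + Real.log A + expIntegralE1 A := ein_eq_add hA
  have hint := integral_one_sub_exp_div_sq hA hAM
  have hE1 := expIntegralE1_eq_integral_add hA hAM
  obtain ⟨-, hE1M⟩ := expIntegralE1_le hM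
  -- interval integrability of the three integrands on `[A, M]`
  have hi1 : IntervalIntegrable (fun y : ℝ => Real.exp (-y) / y) volume A M := by
    refine ((Real.continuous_exp.comp continuous_neg).continuousOn.div continuousOn_id hne).intervalIntegrable
  have hi2 : IntervalIntegrable (fun y : ℝ => Real.exp (-y) / y ^ 2) volume A M := by
    refine ((Real.continuous_exp.comp continuous_neg).continuousOn.div (continuousOn_id.pow 2)
      fun y hy => pow_ne_zero 2 (hne y hy)).intervalIntegrable
  have hi3 : IntervalIntegrable (fun y : ℝ => Real.exp (-y)) volume A M :=
    (Real.continuous_exp.comp continuous_neg).intervalIntegrable _ _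
  -- the bracket `L ∫ e^{-y}/y - 2 ∫ e^{-y}/y² ≤ (L²/8) e^{-A}`
  have hbr : L * (∫ y in A..M, Real.exp (-y) / y) - 2 * ∫ y in A..M, Real.exp (-y) / y ^ 2 ≤
      L ^ 2 / 8 * Real.exp (-A) := by
    have heq : L * (∫ y in A..M, Real.exp (-y) / y) - 2 * ∫ y in A..M, Real.exp (-y) / y ^ 2 =
        ∫ y in A..M, Real.exp (-y) * (L / y - 2 / y ^ 2) := by
      rw [← intervalIntegral.integral_const_mul, ← intervalIntegral.integral_const_mul,
        ← intervalIntegral.integral_sub (hi1.const_mul L) (hi2.const_mul 2)]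
      refine intervalIntegral.integral_congr fun y _ => ?_
      ring
    rw [heq]
    calc ∫ y in A..M, Real.exp (-y) * (L / y - 2 / y ^ 2) ≤ ∫ y in A..M, L ^ 2 / 8 * Real.exp (-y) := by
          refine intervalIntegral.integral_mono_on hAM ?_ (hi3.const_mul _) fun y hy => exp_mul_sub_le (hpos y hy)
          exact (hi3.mul_continuousOn ((continuousOn_const.div continuousOn_id hne).sub
            (continuousOn_const.div (continuousOn_id.pow 2) fun y hy => pow_ne_zero 2 (hne y hy))))
      _ = L ^ 2 / 8 * (Real.exp (-A) - Real.exp (-M)) := by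
          rw [intervalIntegral.integral_const_mul, intervalIntegral.integral_comp_neg (f := Real.exp),
            integral_exp]
      _ ≤ L ^ 2 / 8 * Real.exp (-A) := by
          have : 0 ≤ Real.exp (-M) := (Real.exp_pos _).le
          nlinarith [sq_nonneg L]
  -- `(L²/8) e^{-A} ≤ (L/8) e^{-2}` and `L E₁(M) ≤ 1/(2ℓ)`
  have hexpA : Real.exp (-A) ≤ Real.exp (-2) := by
    rw [Real.exp_le_exp, neg_le_neg_iff, hAdef, le_div_iff₀ hL]; nlinarith
  have hc1 : L ^ 2 / 8 * Real.exp (-A) ≤ L / 8 * Real.exp (-2) := by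
    have : L ^ 2 ≤ L := by nlinarith
    have he0 : 0 ≤ Real.exp (-A) := (Real.exp_pos _).le
    calc L ^ 2 / 8 * Real.exp (-A) ≤ L / 8 * Real.exp (-A) := by gcongr
      _ ≤ L / 8 * Real.exp (-2) := by gcongr
  have hc2 : L * expIntegralE1 M ≤ 1 / (2 * ℓ) := by
    have h1 : expIntegralE1 M ≤ 1 / M := by
      refine hE1M.trans ?_
      gcongr
      rw [Real.exp_le_one_iff]; linarith
    calc L * expIntegralE1 M ≤ 1 * (1 / M) := mul_le_mul hL1.le h1 (le_trans (expIntegralE1_le hM).1 le_rfl |> fun _ => (expIntegralE1_le hM).1) zero_le_one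
      _ = 1 / (2 * ℓ) := by rw [one_mul, hMdef]
  -- logs
  have hlogA : Real.log A = Real.log 2 - Real.log L := by rw [hAdef, Real.log_div (by norm_num) hL.ne']
  have hlogG : Real.log (Real.exp Real.eulerMascheroniConstant / L) = Real.eulerMascheroniConstant - Real.log L := by
    rw [Real.log_div (Real.exp_pos _).ne' hL.ne', Real.log_exp]
  have hnum := one_add_log_two_add_le
  have hAinv : 1 / A = L / 2 := by rw [hAdef]; field_simp
  have hMinv : 1 / M = 1 / (2 * ℓ) := by rw [hMdef]
  have hℓ0 : 0 < ℓ := by linarith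
  have h2ℓ : 0 < 1 / (2 * ℓ) := by positivity
  -- assemble
  rw [hein, hint, hE1, hlogA, hlogG, hAinv, hMinv]
  have he0 : 0 ≤ Real.exp (-2) := (Real.exp_pos _).le
  nlinarith [hbr, hc1, hc2]

/-! ### The error integrals over `α ∈ [1/ℓ², 1]` -/

/-- `∫_{1/ℓ²}^1 dα/α = 2 log ℓ` (`ℓ ≥ 1`). [folklore] -/
theorem integral_inv_alpha {ℓ : ℝ} (hℓ : 1 ≤ ℓ) : ∫ α in (1 / ℓ ^ 2)..1, 1 / α = 2 * Real.log ℓ := by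
  have hℓ0 : 0 < ℓ := by linarith
  rw [integral_one_div_of_pos (by positivity) one_pos, one_div_one_div, Real.log_pow]
  push_cast; ring

/-- `∫_{1/ℓ²}^1 (1 + 1/α) dα ≤ 1 + 2 log ℓ` (`ℓ ≥ 1`). [folklore] -/
theorem integral_one_add_inv_le {ℓ : ℝ} (hℓ : 1 ≤ ℓ) :
    ∫ α in (1 / ℓ ^ 2)..1, (1 + 1 / α) ≤ 1 + 2 * Real.log ℓ := by
  have hℓ0 : 0 < ℓ := by linarith
  have hα₀ : 0 < 1 / ℓ ^ 2 := by positivity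
  have hα₀1 : 1 / ℓ ^ 2 ≤ 1 := by rw [div_le_one (by positivity)]; nlinarith
  have hi : IntervalIntegrable (fun α : ℝ => 1 / α) volume (1 / ℓ ^ 2) 1 := by
    refine (continuousOn_const.div continuousOn_id fun α hα => ?_).intervalIntegrable
    rw [Set.uIcc_of_le hα₀1] at hα
    exact ne_of_gt (hα₀.trans_le hα.1)
  rw [intervalIntegral.integral_add intervalIntegrable_const hi, integral_inv_alpha hℓ,
    intervalIntegral.integral_const, smul_eq_mul, mul_one]
  linarith

/-- `∫_{1/ℓ²}^1 α^{-1/2} dα ≤ 2` (`ℓ ≥ 1`). [folklore] -/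
theorem integral_rpow_neg_half_le {ℓ : ℝ} (hℓ : 1 ≤ ℓ) :
    ∫ α in (1 / ℓ ^ 2)..1, α ^ (-(1 / 2) : ℝ) ≤ 2 := by
  have hℓ0 : 0 < ℓ := by linarith
  rw [integral_rpow (Or.inl (by norm_num))]
  rw [show (-(1 / 2) : ℝ) + 1 = 1 / 2 by norm_num, Real.one_rpow]
  have : 0 ≤ (1 / ℓ ^ 2) ^ (1 / 2 : ℝ) := by positivity
  rw [div_le_iff₀ (by norm_num : (0:ℝ) < 1 / 2)]
  linarith

/-- `min(ℓ, 1/α)` is continuous on `[a, b]` when `0 < a`. [folklore] -/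
theorem continuousOn_min_inv {ℓ a b : ℝ} (ha : 0 < a) :
    ContinuousOn (fun α : ℝ => min ℓ (1 / α)) (Set.Icc a b) := by
  have h : ContinuousOn (fun α : ℝ => 1 / α) (Set.Icc a b) :=
    continuousOn_const.div continuousOn_id fun α hα => ne_of_gt (ha.trans_le hα.1)
  exact continuousOn_const.inf h

/-- `∫_{1/ℓ²}^1 min(ℓ, 1/α)² dα ≤ 2ℓ` (`ℓ ≥ 1`): `ℓ²` on `[1/ℓ², 1/ℓ]` and `1/α²` on `[1/ℓ, 1]`.
[folklore] -/
theorem integral_min_sq_le {ℓ : ℝ} (hℓ : 1 ≤ ℓ) :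
    ∫ α in (1 / ℓ ^ 2)..1, (min ℓ (1 / α)) ^ 2 ≤ 2 * ℓ := by
  have hℓ0 : 0 < ℓ := by linarith
  have hα₀ : 0 < 1 / ℓ ^ 2 := by positivity
  have h01 : 1 / ℓ ^ 2 ≤ 1 / ℓ := by
    rw [div_le_div_iff₀ (by positivity) hℓ0]; nlinarith
  have h11 : 1 / ℓ ≤ 1 := by rw [div_le_one hℓ0]; exact hℓ
  have hcont : ∀ {a b : ℝ}, 0 < a → a ≤ b → IntervalIntegrable (fun α : ℝ => (min ℓ (1 / α)) ^ 2) volume a b :=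
    fun ha hab => ((continuousOn_min_inv (ℓ := ℓ) ha).pow 2).intervalIntegrable_of_Icc hab
  rw [← intervalIntegral.integral_add_adjacent_intervals (hcont hα₀ h01) (hcont (by positivity) h11)]
  -- first piece
  have h1 : ∫ α in (1 / ℓ ^ 2)..(1 / ℓ), (min ℓ (1 / α)) ^ 2 ≤ ℓ := by
    calc ∫ α in (1 / ℓ ^ 2)..(1 / ℓ), (min ℓ (1 / α)) ^ 2 ≤ ∫ α in (1 / ℓ ^ 2)..(1 / ℓ), ℓ ^ 2 := by
          refine intervalIntegral.integral_mono_on h01 (hcont hα₀ h01) intervalIntegrable_const fun α hα => ?_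
          have hmin : min ℓ (1 / α) ≤ ℓ := min_le_left _ _
          have hmin0 : 0 ≤ min ℓ (1 / α) := le_min hℓ0.le (by have := hα₀.trans_le hα.1; positivity)
          exact pow_le_pow_left₀ hmin0 hmin 2
      _ = (1 / ℓ - 1 / ℓ ^ 2) * ℓ ^ 2 := by rw [intervalIntegral.integral_const, smul_eq_mul]
      _ ≤ ℓ := by
          have : (1 / ℓ - 1 / ℓ ^ 2) * ℓ ^ 2 = ℓ - 1 := by field_simp
          rw [this]; linarith
  -- second piece
  have h2 : ∫ α in (1 / ℓ)..1, (min ℓ (1 / α)) ^ 2 ≤ ℓ := by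
    have hi : IntervalIntegrable (fun α : ℝ => 1 / α ^ 2) volume (1 / ℓ) 1 := by
      refine (continuousOn_const.div (continuousOn_id.pow 2) fun α hα => ?_).intervalIntegrable
      rw [Set.uIcc_of_le h11] at hα
      exact pow_ne_zero 2 (ne_of_gt ((by positivity : (0:ℝ) < 1 / ℓ).trans_le hα.1))
    calc ∫ α in (1 / ℓ)..1, (min ℓ (1 / α)) ^ 2 ≤ ∫ α in (1 / ℓ)..1, 1 / α ^ 2 := by
          refine intervalIntegral.integral_mono_on h11 (hcont (by positivity) h11) hi fun α hα => ?_
          have hα0 : 0 < α := (by positivity : (0:ℝ) < 1 / ℓ).trans_le hα.1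
          have hmin : min ℓ (1 / α) ≤ 1 / α := min_le_right _ _
          have hmin0 : 0 ≤ min ℓ (1 / α) := le_min hℓ0.le (by positivity)
          calc (min ℓ (1 / α)) ^ 2 ≤ (1 / α) ^ 2 := pow_le_pow_left₀ hmin0 hmin 2
            _ = 1 / α ^ 2 := by rw [one_div_pow]
      _ = 1 / (1 / ℓ) - 1 / 1 := Halasz.integral_one_div_sq (by positivity) h11
      _ ≤ ℓ := by rw [one_div_one_div, div_one]; linarith
  linarith

/-! ### The two trivial regimes -/

/-- For `1 ≤ L ≤ 9/4`: `1 ≤ L (log(e^γ/L) + 12/7)` (`γ > 1/2`, `log(9/4) = 2 log(3/2) ≤ 1`).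
[cite: GranvilleSoundararajan2003, §4 ("The Theorem is trivial if `1 ≤ L ≤ e^γ + O(1/log x)`")] -/
theorem one_le_mainTerm {L : ℝ} (hL1 : 1 ≤ L) (hL2 : L ≤ 9 / 4) :
    1 ≤ L * (Real.log (Real.exp Real.eulerMascheroniConstant / L) + 12 / 7) := by
  have hL0 : 0 < L := by linarith
  rw [Real.log_div (Real.exp_pos _).ne' hL0.ne', Real.log_exp]
  have hγ := Real.one_half_lt_eulerMascheroniConstant
  have hlog : Real.log L ≤ 1 := by
    calc Real.log L ≤ Real.log (9 / 4) := Real.log_le_log hL0 hL2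
      _ = 2 * Real.log (3 / 2) := by
          rw [show (9 / 4 : ℝ) = (3 / 2) ^ 2 by norm_num, Real.log_pow]; push_cast; ring
      _ ≤ 2 * (3 / 2 - 1) := by gcongr; exact Real.log_le_sub_one_of_pos (by norm_num)
      _ = 1 := by norm_num
  nlinarith

/-- For `0 ≤ L ≤ L₀` with `1 ≤ L₀`: `L (log(e^γ/L) + 12/7) ≥ -L₀ log L₀` (a crude lower bound for
the main term, used for bounded `x`). [folklore] -/
theorem mainTerm_ge_neg {L L₀ : ℝ} (hL : 0 ≤ L) (hLL : L ≤ L₀) (hL₀ : 1 ≤ L₀) :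
    -(L₀ * Real.log L₀) ≤ L * (Real.log (Real.exp Real.eulerMascheroniConstant / L) + 12 / 7) := by
  have hlog0 : 0 ≤ Real.log L₀ := Real.log_nonneg hL₀
  rcases hL.eq_or_lt with hL0 | hLpos
  · rw [← hL0, zero_mul]
    have : 0 ≤ L₀ * Real.log L₀ := by positivity
    linarith
  · rw [Real.log_div (Real.exp_pos _).ne' hLpos.ne', Real.log_exp]
    have hγ := Real.one_half_lt_eulerMascheroniConstant
    have hlogL : Real.log L ≤ Real.log L₀ := Real.log_le_log hLpos hLL
    have h1 : -Real.log L₀ ≤ Real.eulerMascheroniConstant - Real.log L + 12 / 7 := by linarith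
    calc -(L₀ * Real.log L₀) ≤ -(L * Real.log L₀) := by nlinarith
      _ = L * (-Real.log L₀) := by ring
      _ ≤ L * (Real.eulerMascheroniConstant - Real.log L + 12 / 7) := mul_le_mul_of_nonneg_left h1 hL

end GranvilleSoundararajan

end Literature.NumberTheory.LFunctions
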